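import Mathlib
import HarnessLib
import Literature.Computability.AlgebraicComplexity.PatternExpressions
import Summits.ValiantsHypothesis.ValiantsHypothesis.Theorems.MonotoneRestorationOrbitRestorationQPDepthThreeRungDefs

/-!
# Homomorphism polynomials are multiplicative under the tensor (categorical) product of the targets
# (route MonotoneRestoration, crux `OrbitRestorationQP` stmt-ValiantsHypothesis-18293; span currency / TW-LB programme, piece R9b)

Namespace `Summit.ValiantsHypothesis.ValiantsHypothesis.Theorems.HomTensor`.  Definition-free.

For a bipartite multigraph pattern `E` (tree `homPoly E n R = Σ_{h, h'} Π_{(a,b) ∈ E} x_{h a, h' b}`) and two levels `n`, `m` glued into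
one level `N` by a bijection `e : Fin N ≃ Fin n × Fin m`, the KRONECKER SUBSTITUTION `x_{p q} ↦ y_{(e p).1 (e q).1} · z_{(e p).2 (e q).2}`
(the weighted categorical product of an `n`-vertex and an `m`-vertex target, written in the variables `y = inl`, `z = inr` of the sum
ring) maps `hom_{E,N}` to the PRODUCT `hom_{E,n}(y) · hom_{E,m}(z)`:

* `homPoly_kronecker` — **`hom_E(Y ⊗ Z) = hom_E(Y) · hom_E(Z)`** (multiplicativity of homomorphism counts over categorical products,
  Lovász 1967, as a polynomial identity).

Use (memo CLOSURE-RESIDUE-g9 §6): the substitutions `X ↦ X ⊗ Z` for FIXED small weighted targets `Z` act diagonally on the hom basis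
of the matrix-symmetric polynomials (`HomSpan`, `HomExpansionUnique`) with eigenvalues `hom_E(Z)`, preserve depth-three size up to the
factor `|Z|²`, and so separate pattern components of a depth-three-easy family à la Lovász — the isolation step of the TW-LB strategy
for the rung A_∞.  Honest label: a classical identity in the tree's vocabulary; no stub closed; VP ≠ VNP untouched.
[cite: Lovasz1967, §2; DwivediPagoSeppelt2026, §8]
-/

noncomputable section

open scoped Classical

-- `Summit.ValiantsHypothesis.ValiantsHypothesis.…` is the tree's single-conjunct layout (Sub = Summit).
set_option linter.dupNamespace false

namespace Summit.ValiantsHypothesis.ValiantsHypothesis.Theorems.HomTensor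

open MvPolynomial Literature.Computability.AlgebraicComplexity

universe u

/-- Splitting a pair of vertex maps into a glued level along `e : Fin N ≃ Fin n × Fin m` into the two pairs of coordinate maps.
[folklore] -/
theorem exists_splitEquiv {A B : Type u} (N n m : ℕ) (e : Fin N ≃ Fin n × Fin m) :
    ∃ Θ : ((A → Fin N) × (B → Fin N)) ≃ ((A → Fin n) × (B → Fin n)) × ((A → Fin m) × (B → Fin m)),
      ∀ h, Θ h = ((fun a => (e (h.1 a)).1, fun b => (e (h.2 b)).1), (fun a => (e (h.1 a)).2, fun b => (e (h.2 b)).2)) := by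
  refine ⟨{ toFun := fun h => ((fun a => (e (h.1 a)).1, fun b => (e (h.2 b)).1), (fun a => (e (h.1 a)).2, fun b => (e (h.2 b)).2))
            invFun := fun k => (fun a => e.symm (k.1.1 a, k.2.1 a), fun b => e.symm (k.1.2 b, k.2.2 b))
            left_inv := fun h => ?_
            right_inv := fun k => ?_ }, fun h => rfl⟩
  · ext a <;> simp
  · rcases k with ⟨⟨k11, k12⟩, ⟨k21, k22⟩⟩
    simp

/-- **MULTIPLICATIVITY OF HOMOMORPHISM POLYNOMIALS UNDER THE TENSOR PRODUCT OF TARGETS.**  Under the Kronecker substitution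
`x_{p q} ↦ y_{(e p).1, (e q).1} · z_{(e p).2, (e q).2}` along a bijection `e : Fin N ≃ Fin n × Fin m`, the homomorphism polynomial of every
bipartite multigraph pattern at level `N` becomes the product of its homomorphism polynomials at levels `n` (in the variables `y = inl`)
and `m` (in the variables `z = inr`). [cite: Lovasz1967, §2] -/
theorem homPoly_kronecker {A B : Type u} [Fintype A] [DecidableEq A] [Fintype B] [DecidableEq B]
    (E : Multiset (A × B)) {N n m : ℕ} (e : Fin N ≃ Fin n × Fin m) (R : Type*) [CommSemiring R] :
    aeval (fun pq : Fin N × Fin N =>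
        (X (Sum.inl ((e pq.1).1, (e pq.2).1)) * X (Sum.inr ((e pq.1).2, (e pq.2).2)) :
          MvPolynomial ((Fin n × Fin n) ⊕ (Fin m × Fin m)) R)) (homPoly E N R) =
      rename Sum.inl (homPoly E n R) * rename Sum.inr (homPoly E m R) := by
  obtain ⟨Θ, hΘ⟩ := exists_splitEquiv (A := A) (B := B) N n m e
  unfold homPoly
  rw [map_sum, map_sum, map_sum, Finset.sum_mul_sum, ← Finset.sum_product']
  simp only [map_multiset_prod, Multiset.map_map, Function.comp_def, aeval_X, rename_X, Multiset.prod_map_mul]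
  refine Fintype.sum_equiv Θ _ _ fun h => ?_
  rw [hΘ h]

end Summit.ValiantsHypothesis.ValiantsHypothesis.Theorems.HomTensor

end
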